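import Mathlib
import HarnessLib.Audit
import Summits.PneNP.PneNP.Theorems.PstarNorDataTools

/-!
# Every non-centre output of a NOR-structured core closes a triangle, generic form (ROUND-24, GAPTWO-PLAN v1 S4c)

FRONTIER range-avoidance ladder, rung F-N3, ROUND 24 (cell `pnp-ideate`; restricted-model proof complexity — nothing here bears
on `P` versus `NP`).

Generic NOR data `CoreData I J₀ C σ τ g₀` (`PstarNorDataTools`); "chord" below = output of `J₀ ∖ C`.  The one place in the
proof of the NOR-core accounting lemma where a path is needed (memo `CORE-BOUND-NOTES.md` §5, "the long chord is
excluded").  A chord `e = (a, b; ·, ·)` has its XOR pair joined by a walk of centre edges; a shortest such path `a = v₀, …, v_ℓ = b`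
(centre edges `f_i` with XOR pair `{v_i, v_{i+1}}`) has `ℓ ≠ 1` (a centre edge with the XOR pair of `e` IS `e`, simple overlaps) and
`ℓ ≤ 2`: the family `{g₀, e, f₀, …, f_{ℓ-1}}` has at most `ℓ + 4` boundary variables (the cycle `e f₀ ⋯ f_{ℓ-1}` has no private XOR
variable, each `f_i` loses its class variable to the reader `g₀`, and `g₀` loses `σ, τ` to `f₀, f₁`, which lie in different classes as
they share `v₁`) against `3(ℓ + 2) ≤ 2·#bdry`.  So `triangle`/`apex`: an APEX `v` with centre edges `{a, v}`, `{v, b}`, one per class,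
of centre degree two; and `apex_inj`: a chord is determined by its apex.
-/

set_option linter.dupNamespace false

open Finset Literature.Computability.Complexity
open Summit.PneNP.PneNP.Theorems.PstarSALevel (varSet bdry BoundaryExpanding SimpleOverlap)
open Summit.PneNP.PneNP.Theorems.PstarGapLinearised (andPair andPair_subset_varSet)
open Summit.PneNP.PneNP.Theorems.PstarCentreFree (vars_mem_varSet)
open Summit.PneNP.PneNP.Theorems.PstarGapOneKills (mem_andPair_of_slot)
open Summit.PneNP.PneNP.Theorems.PstarNorCoreTools (not_mem_bdry_of_two card_varSet_inter_bdry_le card_bdry_le_sum eq_of_mem_bdry xorPair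
  mem_xorPair_iff xorPair_subset_varSet card_xorPair_le vars_zero_ne_one card_xorPair ne_of_xorPair_eq)
open Summit.PneNP.PneNP.Theorems.PstarNorDataTools

namespace Summit.PneNP.PneNP.Theorems.PstarNorDataTriangle

variable {n m : ℕ}

/-- The CENTRE GRAPH on the variables: `v ~ w` iff `{v, w}` is the XOR pair of a centre edge of `J₀`. -/
def cg (I : LocalMap 4 n m) (C : Finset (Fin m)) : SimpleGraph (Fin n) where
  Adj v w := v ≠ w ∧ CAdj I C v w
  symm := ⟨by
    rintro v w ⟨hne, f, hf, h⟩
    exact ⟨hne.symm, f, hf, h.symm⟩⟩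
  loopless := ⟨fun _ h => h.1 rfl⟩

/-- An edge of the centre graph is the XOR pair of a centre edge. -/
theorem exists_cen_of_adj (I : LocalMap 4 n m) (C : Finset (Fin m)) {v w : Fin n}
    (h : (cg I C).Adj v w) : ∃ f ∈ C, xorPair I f = {v, w} := by
  have h' : v ≠ w ∧ CAdj I C v w := h
  obtain ⟨-, f, hf, hvw⟩ := h'
  refine ⟨f, hf, ?_⟩
  unfold xorPair
  rcases hvw with ⟨h0, h1⟩ | ⟨h0, h1⟩
  · rw [h0, h1]
  · rw [h0, h1, pair_comm]

/-- The chord condition of a NOR structure gives reachability in the centre graph. -/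
theorem reachable_of_reflTransGen (I : LocalMap 4 n m) (C : Finset (Fin m)) {a b : Fin n}
    (h : Relation.ReflTransGen (CAdj I C) a b) : (cg I C).Reachable a b := by
  induction h with
  | refl => exact SimpleGraph.Reachable.refl _
  | @tail b' c _ hbc ih =>
    by_cases hbc' : b' = c
    · exact hbc' ▸ ih
    · exact ih.trans (SimpleGraph.Adj.reachable (show (cg I C).Adj b' c from ⟨hbc', hbc⟩))

section Nor

variable {I : LocalMap 4 n m} {J₀ C : Finset (Fin m)}
variable (hI : I.IsPure xorAndPred) (hS : SimpleOverlap I) {σ τ : Fin n} {g₀ : Fin m} (hN : CoreData I J₀ C σ τ g₀)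
variable {r : ℕ} (hB : BoundaryExpanding r I) (hk : J₀.card < r)

include hI hS hN in
/-- Two distinct centre edges sharing an XOR variable lie in different classes; in particular one of them holds `σ` and the other
`τ`. -/
theorem sigma_tau_of_shared {f f' : Fin m} (hf : f ∈ C) (hf' : f' ∈ C) (hne : f ≠ f') {v : Fin n}
    (hv : v ∈ xorPair I f) (hv' : v ∈ xorPair I f') :
    (f ∈ cls I C σ ∧ f' ∈ cls I C τ) ∨ (f ∈ cls I C τ ∧ f' ∈ cls I C σ) := by
  have hvσ := xor_ne_sigma hI hS hN hf hv
  rcases mem_cls_or hN hf with h1 | h1 <;> rcases mem_cls_or hN hf' with h2 | h2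
  · exact absurd (cls_share hS h1 h2 hne hvσ.1 (xorPair_subset_varSet I f hv) (xorPair_subset_varSet I f' hv')) id
  · exact Or.inl ⟨h1, h2⟩
  · exact Or.inr ⟨h1, h2⟩
  · exact absurd (cls_share hS h1 h2 hne hvσ.2 (xorPair_subset_varSet I f hv) (xorPair_subset_varSet I f' hv')) id

include hI hS hN hB hk in
/-- **Every chord closes a triangle.**  For a chord `e` with XOR pair `(a, b)` there are an apex `v` and distinct centre edges `f₁`,
`f₂` with XOR pairs `{a, v}` and `{v, b}`. -/
theorem triangle {e : Fin m} (he : e ∈ (J₀ \ C)) :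
    ∃ v : Fin n, ∃ f₁ ∈ C, ∃ f₂ ∈ C, f₁ ≠ f₂ ∧
      xorPair I f₁ = {I.vars e 0, v} ∧ xorPair I f₂ = {v, I.vars e 1} := by
  classical
  obtain ⟨heJ, hec⟩ := mem_sdiff.1 he
  set a := I.vars e 0 with ha
  set b := I.vars e 1 with hb
  have hab : a ≠ b := vars_zero_ne_one I hI e
  -- a shortest centre path from `a` to `b`
  obtain ⟨p⟩ := reachable_of_reflTransGen I C (hN.2.2.2.2.2 e heJ hec)
  set q := p.bypass with hq
  have hpath : q.IsPath := p.bypass_isPath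
  set ℓ := q.length with hℓ
  have hinj : ∀ i ≤ ℓ, ∀ j ≤ ℓ, q.getVert i = q.getVert j → i = j :=
    fun i hi j hj h => hpath.getVert_injOn (by simpa using hi) (by simpa using hj) h
  have hv0 : q.getVert 0 = a := q.getVert_zero
  have hvℓ : q.getVert ℓ = b := q.getVert_length
  -- centre edges along the path
  have hch : ∀ i, i < ℓ → ∃ f ∈ C, xorPair I f = {q.getVert i, q.getVert (i + 1)} :=
    fun i hi => exists_cen_of_adj I C (q.adj_getVert_succ hi)
  haveI : Nonempty (Fin m) := ⟨e⟩
  choose! f hf using hch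
  -- ℓ = 0, 1 are impossible
  have hℓ0 : ℓ ≠ 0 := fun h0 => hab (by rw [← hv0, ← hvℓ, h0])
  have hℓ1 : ℓ ≠ 1 := by
    intro h1
    obtain ⟨hf0, hx0⟩ := hf 0 (by omega)
    rw [hv0, zero_add, ← h1, hvℓ] at hx0
    have : f 0 = e := ne_of_xorPair_eq I hI hS (by rw [hx0]; rfl)
    exact ne_of_mem_of_mem_sdiff hf0 he this
  -- injectivity of `f` along the path
  have hfinj : ∀ i < ℓ, ∀ j < ℓ, f i = f j → i = j := by
    intro i hi j hj hij
    have hx : ({q.getVert i, q.getVert (i + 1)} : Finset (Fin n)) = {q.getVert j, q.getVert (j + 1)} := by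
      rw [← (hf i hi).2, ← (hf j hj).2, hij]
    have h1 : q.getVert i ∈ ({q.getVert j, q.getVert (j + 1)} : Finset (Fin n)) := hx ▸ mem_insert_self _ _
    have h2 : q.getVert j ∈ ({q.getVert i, q.getVert (i + 1)} : Finset (Fin n)) := hx.symm ▸ mem_insert_self _ _
    rw [mem_insert, mem_singleton] at h1 h2
    rcases h1 with h1 | h1
    · exact hinj i hi.le j hj.le h1
    rcases h2 with h2 | h2
    · exact (hinj j hj.le i hi.le h2).symm
    have := hinj i hi.le (j + 1) hj h1
    have := hinj j hj.le (i + 1) hi h2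
    omega
  by_cases hℓ2 : ℓ = 2
  · -- the triangle
    refine ⟨q.getVert 1, f 0, (hf 0 (by omega)).1, f 1, (hf 1 (by omega)).1, fun h => ?_, ?_, ?_⟩
    · have := hfinj 0 (by omega) 1 (by omega) h; omega
    · rw [(hf 0 (by omega)).2, hv0]
    · rw [(hf 1 (by omega)).2, show (1 : ℕ) + 1 = ℓ by omega, hvℓ]
  · -- ℓ ≥ 3: the cycle family violates expansion
    exfalso
    have hℓ3 : 3 ≤ ℓ := by omega
    have hg₀ : g₀ ∉ J₀ := hN.2.2.1
    set F := (range ℓ).image f with hF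
    have hFsub : F ⊆ C := by
      intro j hj
      obtain ⟨i, hi, rfl⟩ := mem_image.1 hj
      exact (hf i (mem_range.1 hi)).1
    have hFcard : F.card = ℓ := by
      rw [hF, card_image_of_injOn fun i hi j hj h => hfinj i (mem_range.1 hi) j (mem_range.1 hj) h, card_range]
    have heF : e ∉ F := fun h => ne_of_mem_of_mem_sdiff (hFsub h) he rfl
    have hg₀F : g₀ ∉ insert e F := by
      rw [mem_insert, not_or]; exact ⟨fun h => hg₀ (h ▸ heJ), fun h => hg₀ (hN.1 (hFsub h))⟩
    set X := insert g₀ (insert e F) with hX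
    have hXcard : X.card = ℓ + 2 := by rw [hX, card_insert_of_notMem hg₀F, card_insert_of_notMem heF, hFcard]
    have hXsub : X ⊆ insert g₀ J₀ := by
      intro j hj
      rcases mem_insert.1 hj with rfl | hj
      · exact mem_insert_self _ _
      rcases mem_insert.1 hj with rfl | hj
      · exact mem_insert_of_mem heJ
      · exact mem_insert_of_mem (hN.1 (hFsub hj))
    have hXr : X.card ≤ r := (card_le_card hXsub).trans (by rw [card_insert_of_notMem hg₀]; omega)
    have hexp := hB X hXr
    have hfX : ∀ i < ℓ, f i ∈ X := fun i hi => mem_insert_of_mem (mem_insert_of_mem (mem_image.2 ⟨i, mem_range.2 hi, rfl⟩))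
    have heX : e ∈ X := mem_insert_of_mem (mem_insert_self _ _)
    have hgX : g₀ ∈ X := mem_insert_self _ _
    have hfe : ∀ i < ℓ, f i ≠ e := fun i hi => ne_of_mem_of_mem_sdiff (hf i hi).1 he
    have hfg : ∀ i < ℓ, f i ≠ g₀ := fun i hi h => hg₀ (h ▸ hN.1 (hf i hi).1)
    -- every XOR variable of `f i` is read by another member of `X`
    have hcover : ∀ i < ℓ, ∀ w ∈ xorPair I (f i), ∃ j ∈ X, f i ≠ j ∧ w ∈ varSet I j := by
      intro i hi w hw
      rw [(hf i hi).2, mem_insert, mem_singleton] at hw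
      rcases hw with rfl | rfl
      · by_cases hi0 : i = 0
        · subst hi0
          refine ⟨e, heX, hfe 0 hi, ?_⟩
          rw [hv0]; exact vars_mem_varSet I e 0
        · refine ⟨f (i - 1), hfX (i - 1) (by omega), fun h => ?_, ?_⟩
          · have := hfinj i hi (i - 1) (by omega) h; omega
          · apply xorPair_subset_varSet
            rw [(hf (i - 1) (by omega)).2, show i - 1 + 1 = i by omega]
            exact mem_insert_of_mem (mem_singleton_self _)
      · by_cases hiℓ : i + 1 = ℓ
        · refine ⟨e, heX, hfe i hi, ?_⟩
          rw [hiℓ, hvℓ]; exact vars_mem_varSet I e 1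
        · refine ⟨f (i + 1), hfX (i + 1) (by omega), fun h => ?_, ?_⟩
          · have := hfinj i hi (i + 1) (by omega) h; omega
          · apply xorPair_subset_varSet
            rw [(hf (i + 1) (by omega)).2]
            exact mem_insert_self _ _
    -- `σ` and `τ` are read inside `X` by `f 0`, `f 1`
    have hστ : (∃ j ∈ X, j ≠ g₀ ∧ σ ∈ varSet I j) ∧ (∃ j ∈ X, j ≠ g₀ ∧ τ ∈ varSet I j) := by
      have h0 := hf 0 (by omega)
      have h1 := hf 1 (by omega)
      have hne : f 0 ≠ f 1 := fun h => by have := hfinj 0 (by omega) 1 (by omega) h; omega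
      have hv1 : q.getVert 1 ∈ xorPair I (f 0) := by rw [h0.2]; exact mem_insert_of_mem (mem_singleton_self _)
      have hv1' : q.getVert 1 ∈ xorPair I (f 1) := by rw [h1.2]; exact mem_insert_self _ _
      have mk : ∀ {ρ : Fin n} {j : Fin m} (i : ℕ), i < ℓ → j = f i → j ∈ cls I C ρ → ∃ j ∈ X, j ≠ g₀ ∧ ρ ∈ varSet I j :=
        fun i hi hj hc => ⟨_, hj ▸ hfX i hi, hj ▸ hfg i hi, andPair_subset_varSet I _ ((mem_cls I C).1 hc).2⟩
      rcases sigma_tau_of_shared hI hS hN h0.1 h1.1 hne hv1 hv1' with ⟨hσ, hτ⟩ | ⟨hτ, hσ⟩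
      · exact ⟨mk 0 (by omega) rfl hσ, mk 1 (by omega) rfl hτ⟩
      · exact ⟨mk 1 (by omega) rfl hσ, mk 0 (by omega) rfl hτ⟩
    -- per-output bounds
    let qb : Fin m → ℕ := fun j => if j = g₀ then 2 else if j = e then 2 else 1
    have hqb : ∀ j ∈ X, (varSet I j ∩ bdry I X).card ≤ qb j := by
      intro j hj
      rcases mem_insert.1 hj with rfl | hj
      · -- the reader
        simp only [qb, if_true]
        obtain ⟨sσ, hsσ⟩ : ∃ s : Fin 4, I.vars j s = σ := by
          rcases hN.2.2.2.1 with ⟨h, -⟩ | ⟨-, h⟩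
          · exact ⟨2, h⟩
          · exact ⟨3, h⟩
        obtain ⟨sτ, hsτ⟩ : ∃ s : Fin 4, I.vars j s = τ := by
          rcases hN.2.2.2.1 with ⟨-, h⟩ | ⟨h, -⟩
          · exact ⟨3, h⟩
          · exact ⟨2, h⟩
        have hst : sσ ≠ sτ := fun h => hN.2.1 (by rw [← hsσ, ← hsτ, h])
        have := card_varSet_inter_bdry_le I X j {sσ, sτ} fun s hs => by
          rw [mem_insert, mem_singleton] at hs
          rcases hs with h | h
          · obtain ⟨j', hj', hne, hσj⟩ := hστ.1
            rw [h, hsσ]; exact not_mem_bdry_of_two I hgX hj' hne.symm (hsσ ▸ vars_mem_varSet I j sσ) hσj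
          · obtain ⟨j', hj', hne, hτj⟩ := hστ.2
            rw [h, hsτ]; exact not_mem_bdry_of_two I hgX hj' hne.symm (hsτ ▸ vars_mem_varSet I j sτ) hτj
        rw [card_pair hst] at this
        exact this
      rcases mem_insert.1 hj with rfl | hj
      · -- the chord: its XOR slots lie on `f 0` and `f (ℓ - 1)`
        have hjg : j ≠ g₀ := fun h => hg₀ (h ▸ heJ)
        simp only [qb, if_neg hjg, if_true]
        have := card_varSet_inter_bdry_le I X j {0, 1} fun s hs => by
          rw [mem_insert, mem_singleton] at hs
          rcases hs with rfl | rfl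
          · refine not_mem_bdry_of_two I heX (hfX 0 (by omega)) (hfe 0 (by omega)).symm (vars_mem_varSet I j 0) ?_
            apply xorPair_subset_varSet
            rw [(hf 0 (by omega)).2, hv0]
            exact mem_insert_self _ _
          · refine not_mem_bdry_of_two I heX (hfX (ℓ - 1) (by omega)) (hfe (ℓ - 1) (by omega)).symm
              (vars_mem_varSet I j 1) ?_
            apply xorPair_subset_varSet
            rw [(hf (ℓ - 1) (by omega)).2, show ℓ - 1 + 1 = ℓ by omega, hvℓ]
            exact mem_insert_of_mem (mem_singleton_self _)
        simpa using this
      · -- a path edge `f i`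
        obtain ⟨i, hi, rfl⟩ := mem_image.1 hj
        rw [mem_range] at hi
        simp only [qb, if_neg (hfg i hi), if_neg (hfe i hi)]
        obtain ⟨hfc, hfx⟩ := hf i hi
        obtain ⟨sρ, hsρ2, hsρ⟩ : ∃ s : Fin 4, 2 ≤ s.val ∧ (I.vars (f i) s = σ ∨ I.vars (f i) s = τ) := by
          rcases hN.2.2.2.2.1 (f i) hfc with h | h | h | h
          · exact ⟨2, by decide, Or.inl h⟩
          · exact ⟨2, by decide, Or.inr h⟩
          · exact ⟨3, by decide, Or.inl h⟩
          · exact ⟨3, by decide, Or.inr h⟩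
        have hρb : I.vars (f i) sρ ∉ bdry I X := by
          rcases hsρ with h | h
          · rw [h]; exact not_mem_bdry_of_two I (hfX i hi) hgX (hfg i hi) (h ▸ vars_mem_varSet I (f i) sρ) (sigma_mem_reader hN)
          · rw [h]; exact not_mem_bdry_of_two I (hfX i hi) hgX (hfg i hi) (h ▸ vars_mem_varSet I (f i) sρ) (tau_mem_reader hN)
        have h0 : (0 : Fin 4) ≠ sρ := fun h => by rw [← h] at hsρ2; exact absurd hsρ2 (by decide)
        have h1 : (1 : Fin 4) ≠ sρ := fun h => by rw [← h] at hsρ2; exact absurd hsρ2 (by decide)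
        have hxs : ∀ s : Fin 4, s.val < 2 → I.vars (f i) s ∉ bdry I X := by
          intro s hs
          have hw : I.vars (f i) s ∈ xorPair I (f i) := by
            rw [mem_xorPair_iff]
            fin_cases s
            · exact Or.inl rfl
            · exact Or.inr rfl
            · exact absurd hs (by decide)
            · exact absurd hs (by decide)
          obtain ⟨j', hj', hne, hwj⟩ := hcover i hi _ hw
          exact not_mem_bdry_of_two I (hfX i hi) hj' hne (vars_mem_varSet I (f i) s) hwj
        have := card_varSet_inter_bdry_le I X (f i) {0, 1, sρ} fun s hs => by
          simp only [mem_insert, mem_singleton] at hs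
          rcases hs with rfl | rfl | rfl
          · exact hxs 0 (by decide)
          · exact hxs 1 (by decide)
          · exact hρb
        have hcard : ({0, 1, sρ} : Finset (Fin 4)).card = 3 := by
          rw [card_insert_of_notMem, card_pair h1]
          simp only [mem_insert, mem_singleton, not_or]
          exact ⟨by decide, h0⟩
        rw [hcard] at this
        simpa using this
    have hsum := card_bdry_le_sum I X qb hqb
    have hge : e ≠ g₀ := fun h => hg₀ (h ▸ heJ)
    have hqsum : ∑ j ∈ X, qb j = 2 + (2 + ℓ) := by
      rw [hX, sum_insert hg₀F, sum_insert heF]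
      have h1 : qb g₀ = 2 := by simp [qb]
      have h2 : qb e = 2 := by simp only [qb, if_neg hge, if_true]
      have h3 : ∑ j ∈ F, qb j = ℓ := by
        rw [sum_congr rfl (g := fun _ => 1) fun j hj => ?_, sum_const, smul_eq_mul, mul_one, hFcard]
        obtain ⟨i, hi, rfl⟩ := mem_image.1 hj
        rw [mem_range] at hi
        simp only [qb, if_neg (hfg i hi), if_neg (hfe i hi)]
      rw [h1, h2, h3]
    rw [hqsum] at hsum
    rw [hXcard] at hexp
    omega

include hI hS hN hB hk in
/-- **The apex**: packaged form of `triangle` with the class information — the two centre edges at the apex are one in each class,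
the apex differs from both ends, and has centre degree two. -/
theorem apex {e : Fin m} (he : e ∈ (J₀ \ C)) :
    ∃ v : Fin n, ∃ f₁ ∈ C, ∃ f₂ ∈ C, f₁ ≠ f₂ ∧ xorPair I f₁ = {I.vars e 0, v} ∧ xorPair I f₂ = {v, I.vars e 1} ∧
      v ≠ I.vars e 0 ∧ v ≠ I.vars e 1 ∧ cdeg I C v = 2 ∧
      ((f₁ ∈ cls I C σ ∧ f₂ ∈ cls I C τ) ∨ (f₁ ∈ cls I C τ ∧ f₂ ∈ cls I C σ)) := by
  classical
  obtain ⟨v, f₁, hf₁, f₂, hf₂, hne, hx₁, hx₂⟩ := triangle hI hS hN hB hk he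
  have hv₁ : v ∈ xorPair I f₁ := by rw [hx₁]; exact mem_insert_of_mem (mem_singleton_self _)
  have hv₂ : v ∈ xorPair I f₂ := by rw [hx₂]; exact mem_insert_self _ _
  have hva : v ≠ I.vars e 0 := by
    intro h
    have : (xorPair I f₁).card = 2 := card_xorPair I hI f₁
    rw [hx₁, h, pair_eq_singleton, card_singleton] at this
    exact absurd this (by decide)
  have hvb : v ≠ I.vars e 1 := by
    intro h
    have : (xorPair I f₂).card = 2 := card_xorPair I hI f₂
    rw [hx₂, h, pair_eq_singleton, card_singleton] at this
    exact absurd this (by decide)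
  refine ⟨v, f₁, hf₁, f₂, hf₂, hne, hx₁, hx₂, hva, hvb, ?_, sigma_tau_of_shared hI hS hN hf₁ hf₂ hne hv₁ hv₂⟩
  have h2 : 2 ≤ cdeg I C v := by
    unfold cdeg
    have hsub : ({f₁, f₂} : Finset (Fin m)) ⊆ (C).filter fun f => v ∈ xorPair I f := by
      intro f hf
      rw [mem_insert, mem_singleton] at hf
      rcases hf with rfl | rfl
      · exact mem_filter.2 ⟨hf₁, hv₁⟩
      · exact mem_filter.2 ⟨hf₂, hv₂⟩
    have := card_le_card hsub
    rwa [card_pair hne] at this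
  have := cdeg_le_two hI hS hN v
  omega

include hI hS hN in
/-- **Apex injectivity**: the centre edge of a given class through a vertex is unique, so a chord is determined by its apex. -/
theorem apex_inj {e e' : Fin m} {v : Fin n} {f₁ f₂ f₁' f₂' : Fin m} (hf₁ : f₁ ∈ C) (hf₂ : f₂ ∈ C)
    (hf₁' : f₁' ∈ C) (hf₂' : f₂' ∈ C) (hne : f₁ ≠ f₂) (hne' : f₁' ≠ f₂')
    (hx₁ : xorPair I f₁ = {I.vars e 0, v}) (hx₂ : xorPair I f₂ = {v, I.vars e 1})
    (hx₁' : xorPair I f₁' = {I.vars e' 0, v}) (hx₂' : xorPair I f₂' = {v, I.vars e' 1})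
    (hva : v ≠ I.vars e 0) (hvb : v ≠ I.vars e 1) (hva' : v ≠ I.vars e' 0) (hvb' : v ≠ I.vars e' 1) : e = e' := by
  classical
  have hv₁ : v ∈ xorPair I f₁ := by rw [hx₁]; exact mem_insert_of_mem (mem_singleton_self _)
  have hv₂ : v ∈ xorPair I f₂ := by rw [hx₂]; exact mem_insert_self _ _
  have hv₁' : v ∈ xorPair I f₁' := by rw [hx₁']; exact mem_insert_of_mem (mem_singleton_self _)
  have hv₂' : v ∈ xorPair I f₂' := by rw [hx₂']; exact mem_insert_self _ _
  have hvσ := xor_ne_sigma hI hS hN hf₁ hv₁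
  have uniq : ∀ {ρ : Fin n} {f f' : Fin m}, v ≠ ρ → f ∈ cls I C ρ → f' ∈ cls I C ρ → v ∈ xorPair I f → v ∈ xorPair I f' →
      f = f' := by
    intro ρ f f' hρ hf hf' hvf hvf'
    by_contra h
    exact cls_share hS hf hf' h hρ (xorPair_subset_varSet I f hvf) (xorPair_subset_varSet I f' hvf')
  have key : ∀ {a₁ a₂ b₁ b₂ : Fin m}, a₁ ∈ C → b₁ ∈ C → b₂ ∈ C → b₁ ≠ b₂ →
      v ∈ xorPair I a₁ → v ∈ xorPair I b₁ → v ∈ xorPair I b₂ → a₁ ∈ ({b₁, b₂} : Finset (Fin m)) := by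
    intro a₁ a₂ b₁ b₂ ha₁ hb₁ hb₂ hnb hva₁ hvb₁ hvb₂
    rw [mem_insert, mem_singleton]
    have hb := sigma_tau_of_shared hI hS hN hb₁ hb₂ hnb hvb₁ hvb₂
    rcases mem_cls_or hN ha₁ with h | h
    · rcases hb with ⟨h', -⟩ | ⟨-, h'⟩
      · exact Or.inl (uniq hvσ.1 h h' hva₁ hvb₁)
      · exact Or.inr (uniq hvσ.1 h h' hva₁ hvb₂)
    · rcases hb with ⟨-, h'⟩ | ⟨h', -⟩
      · exact Or.inr (uniq hvσ.2 h h' hva₁ hvb₂)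
      · exact Or.inl (uniq hvσ.2 h h' hva₁ hvb₁)
  have hpair : ({f₁, f₂} : Finset (Fin m)) = {f₁', f₂'} := by
    apply Subset.antisymm
    · intro x hx
      rw [mem_insert, mem_singleton] at hx
      rcases hx with rfl | rfl
      · exact key (a₂ := f₂) hf₁ hf₁' hf₂' hne' hv₁ hv₁' hv₂'
      · exact key (a₂ := f₁) hf₂ hf₁' hf₂' hne' hv₂ hv₁' hv₂'
    · intro x hx
      rw [mem_insert, mem_singleton] at hx
      rcases hx with rfl | rfl
      · exact key (a₂ := f₂') hf₁' hf₁ hf₂ hne hv₁' hv₁ hv₂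
      · exact key (a₂ := f₁') hf₂' hf₁ hf₂ hne hv₂' hv₁ hv₂
  have hrec : ∀ {d p₁ p₂ : Fin m}, xorPair I p₁ = {I.vars d 0, v} → xorPair I p₂ = {v, I.vars d 1} → v ≠ I.vars d 0 →
      v ≠ I.vars d 1 → xorPair I d = (({p₁, p₂} : Finset (Fin m)).biUnion (xorPair I)) \ {v} := by
    intro d p₁ p₂ h1 h2 hv0 hv1
    rw [biUnion_insert, singleton_biUnion, h1, h2]
    ext w
    simp only [xorPair, mem_sdiff, mem_union, mem_insert, mem_singleton]
    constructor
    · rintro (rfl | rfl)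
      · exact ⟨Or.inl (Or.inl rfl), fun h => hv0 h.symm⟩
      · exact ⟨Or.inr (Or.inr rfl), fun h => hv1 h.symm⟩
    · rintro ⟨(h | h) | (h | h), hne⟩
      · exact Or.inl h
      · exact absurd h hne
      · exact absurd h hne
      · exact Or.inr h
  have h := hrec hx₁ hx₂ hva hvb
  rw [hpair] at h
  exact ne_of_xorPair_eq I hI hS (h.trans (hrec hx₁' hx₂' hva' hvb').symm)

end Nor

end Summit.PneNP.PneNP.Theorems.PstarNorDataTriangle
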